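import Literature.Geometry.GeometricMeasureTheory.CubicalModel
import HarnessLib

/-!
# Smoothness of the cubical retractions off a hyperplane arrangement; translate-avoidance

Support file for the proof of the named fact
`Literature.Geometry.GeometricMeasureTheory.Federer1969_compactness_integralCurrents`
(Federer–Fleming compactness, [Federer1969, 4.2.17 (2)]), on the way to the deformation theorem
4.2.9: rectifiability of the deformed currents is obtained from the SMOOTH push-forward theorem
(`PushforwardRectifiable.lean`, Federer 4.1.30 for smooth maps) applied off the singular set of the
retractions `σ_m` of `CubicalSubdivision.lean` / `CubicalModel.lean`, which is uncharged after a
generic translation. This file supplies the two ingredients: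

* **`σ_m` is smooth on the regular set** `Cubical.regularSet n` — no coordinate an integer, the
  `|offsetᵢ|` pairwise distinct (an open set): there the order statistic `u_m = kth m |offset|` is
  the `|offset|` of the coordinate of rank `m` (`Cubical.kth_eq_of_rank`, ranks are locally constant,
  `Cubical.rank_eq_rank_of_close`), `evenRound` is locally constant
  (`Cubical.evenRound_eq_evenRound`) and each `clamp(offsetᵢ/u_m)` is locally either the rational
  function `(xᵢ − Eᵢ)/(± (x_{i₀} − E₀))` or the constant `± 1` (`Cubical.sigma_eventuallyEq`); hence
  `Cubical.contDiffAt_sigma`, and in `V`: `Cubical.contDiffAt_sigmaV` at every point whose model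
  coordinates are regular; the complement `Cubical.singularSetV b ε` is closed and lies in the
  countable union of affine hyperplanes `⟪ν, x⟫ = ε c`, `ν ∈ Cubical.normals b` (the `bᵢ`,
  `bᵢ ± bⱼ`; finite, nonzero), `c ∈ ℤ` (`Cubical.singularSetV_subset`);
* **translate-avoidance**: level sets of a nonzero linear functional are Haar-null
  (`Cubical.addHaar_levelSet_eq_zero`), a finite measure charges only countably many levels of a
  measurable function (`Cubical.countable_charged_levels`), hence for every finite measure `μ` on `V`
  and almost every model translation `a`, `μ {x : model x + a ∉ O} = 0`
  (`Cubical.ae_measure_translate_singular_eq_zero`); combined with the averaging lemma: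
  `Cubical.exists_good_translate'`, **`Cubical.exists_good_translateV'`** (good translations as in
  `CubicalModel.exists_good_translateV` which moreover make the translated singular set null for
  finitely many given finite measures).

## References

* H. Federer, *Geometric Measure Theory*, Springer 1969, 4.2.5–4.2.9 (held copy
  `lit book:federernd-geometric-measure-theory`, PDF pp. 340–345) [Federer1969].
-/

noncomputable section

open scoped Topology ContDiff
open Set Filter Metric Function

namespace Literature.Geometry.GeometricMeasureTheory

namespace Cubical

variable {n : ℕ}

/-! ### Order statistics at vectors with distinct entries -/

/-- The rank of the entry `i`: the number of strictly smaller entries. [folklore] -/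
def rank (v : Fin n → ℝ) (i : Fin n) : ℕ := (Finset.univ.filter fun j => v j < v i).card

/-- For distinct entries the rank is strictly monotone in the value. [folklore] -/
theorem rank_lt_rank {v : Fin n → ℝ} (hv : Function.Injective v) {i j : Fin n} :
    rank v i < rank v j ↔ v i < v j := by
  have key : ∀ {i j : Fin n}, v i < v j → rank v i < rank v j := fun {i j} hlt => by
    unfold rank
    refine Finset.card_lt_card ⟨fun l hl => ?_, fun h' => ?_⟩
    · simp only [Finset.mem_filter, Finset.mem_univ, true_and] at hl ⊢; exact hl.trans hlt
    · have := (Finset.mem_filter.1 (h' (Finset.mem_filter.2 ⟨Finset.mem_univ i, hlt⟩))).2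
      exact lt_irrefl _ this
  constructor
  · intro h
    by_contra hle
    push Not at hle
    rcases hle.lt_or_eq with hlt | heq
    · exact lt_asymm h (key hlt)
    · rw [hv heq] at h; exact lt_irrefl _ h
  · exact key

/-- **The order statistic is the entry of the right rank** when the entries are distinct:
if `#{j : vⱼ < vᵢ} = k` then `kth k v = vᵢ`. [folklore] -/
theorem kth_eq_of_rank {v : Fin n → ℝ} (hv : Function.Injective v) {k : ℕ} {i : Fin n}
    (hi : rank v i = k) : kth k v = v i := by
  have hk : k < n := by
    rw [← hi, rank]
    calc (Finset.univ.filter fun j => v j < v i).card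
        < (Finset.univ : Finset (Fin n)).card :=
          Finset.card_lt_card ⟨Finset.filter_subset _ _, fun h => by
            have := (Finset.mem_filter.1 (h (Finset.mem_univ i))).2
            exact lt_irrefl _ this⟩
      _ = n := by rw [Finset.card_univ, Fintype.card_fin]
  -- `kth k v` is one of the values
  obtain ⟨I, hIcard, hI⟩ := exists_card_eq_kth hk v
  have hIne : I.Nonempty := Finset.card_pos.1 (by omega)
  obtain ⟨i', hi'I, hi'⟩ := exists_mem_eq_maxOn hIne v
  have hkth : kth k v = v i' := by rw [hI, hi']
  -- its rank is `k`
  have h1 := card_lt_kth_le hk v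
  have h2 := card_le_kth hk v
  rw [hkth] at h1 h2
  have hle_eq : (Finset.univ.filter fun j => v j ≤ v i') = insert i' (Finset.univ.filter fun j => v j < v i') := by
    ext j
    simp only [Finset.mem_filter, Finset.mem_univ, true_and, Finset.mem_insert]
    constructor
    · intro h
      rcases h.lt_or_eq with h' | h'
      · exact Or.inr h'
      · exact Or.inl (hv h')
    · rintro (rfl | h)
      · exact le_rfl
      · exact h.le
  have hnot : i' ∉ (Finset.univ.filter fun j => v j < v i') := by simp
  rw [hle_eq, Finset.card_insert_of_notMem hnot] at h2
  have hrank' : rank v i' = k := by unfold rank; omega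
  -- ranks are injective for distinct values
  have hii' : i = i' := by
    by_contra hne
    rcases lt_or_gt_of_ne (hv.ne hne) with hlt | hlt
    · have : rank v i < rank v i' := by
        unfold rank
        refine Finset.card_lt_card ⟨fun j hj => ?_, fun h => ?_⟩
        · simp only [Finset.mem_filter, Finset.mem_univ, true_and] at hj ⊢; exact hj.trans hlt
        · have := (Finset.mem_filter.1 (h (Finset.mem_filter.2 ⟨Finset.mem_univ i, hlt⟩))).2
          exact lt_irrefl _ this
      omega
    · have : rank v i' < rank v i := by
        unfold rank
        refine Finset.card_lt_card ⟨fun j hj => ?_, fun h => ?_⟩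
        · simp only [Finset.mem_filter, Finset.mem_univ, true_and] at hj ⊢; exact hj.trans hlt
        · have := (Finset.mem_filter.1 (h (Finset.mem_filter.2 ⟨Finset.mem_univ i', hlt⟩))).2
          exact lt_irrefl _ this
      omega
  rw [hkth, hii']

/-- For distinct entries and `k < n` there is an entry of rank `k`. [folklore] -/
theorem exists_rank_eq {v : Fin n → ℝ} (hv : Function.Injective v) {k : ℕ} (hk : k < n) :
    ∃ i, rank v i = k := by
  -- the rank map is injective into `Fin n`, hence surjective
  have hinj : Function.Injective (rank v) := by
    intro i i' h
    by_contra hne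
    rcases lt_or_gt_of_ne (hv.ne hne) with hlt | hlt
    · have : rank v i < rank v i' := by
        unfold rank
        refine Finset.card_lt_card ⟨fun j hj => ?_, fun h' => ?_⟩
        · simp only [Finset.mem_filter, Finset.mem_univ, true_and] at hj ⊢; exact hj.trans hlt
        · have := (Finset.mem_filter.1 (h' (Finset.mem_filter.2 ⟨Finset.mem_univ i, hlt⟩))).2
          exact lt_irrefl _ this
      omega
    · have : rank v i' < rank v i := by
        unfold rank
        refine Finset.card_lt_card ⟨fun j hj => ?_, fun h' => ?_⟩
        · simp only [Finset.mem_filter, Finset.mem_univ, true_and] at hj ⊢; exact hj.trans hlt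
        · have := (Finset.mem_filter.1 (h' (Finset.mem_filter.2 ⟨Finset.mem_univ i', hlt⟩))).2
          exact lt_irrefl _ this
      omega
  have hlt : ∀ i, rank v i < n := fun i => by
    unfold rank
    calc (Finset.univ.filter fun j => v j < v i).card < (Finset.univ : Finset (Fin n)).card :=
          Finset.card_lt_card ⟨Finset.filter_subset _ _, fun h => by
            have := (Finset.mem_filter.1 (h (Finset.mem_univ i))).2
            exact lt_irrefl _ this⟩
      _ = n := by rw [Finset.card_univ, Fintype.card_fin]
  set ρ : Fin n → Fin n := fun i => ⟨rank v i, hlt i⟩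
  have hρ : Function.Injective ρ := fun i i' h => hinj (by simpa [ρ] using congrArg Fin.val h)
  obtain ⟨i, hi⟩ := (Finite.injective_iff_surjective.1 hρ) ⟨k, hk⟩
  exact ⟨i, by simpa [ρ] using congrArg Fin.val hi⟩

/-- **Local constancy of the rank**: if the entries of `v₀` are distinct, then for `w` uniformly
close to `v₀` the strict order, hence every rank, is unchanged. [folklore] -/
theorem rank_eq_rank_of_close {v₀ w : Fin n → ℝ} (hv : Function.Injective v₀) {δ : ℝ}
    (hδ : ∀ i j, i ≠ j → 2 * δ < |v₀ i - v₀ j|) (hw : ∀ i, |w i - v₀ i| < δ) (i : Fin n) :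
    rank w i = rank v₀ i := by
  unfold rank
  congr 1
  ext j
  simp only [Finset.mem_filter, Finset.mem_univ, true_and]
  by_cases hij : j = i
  · subst hij; simp
  have h := hδ j i hij
  have hj := hw j
  have hi := hw i
  rw [abs_lt] at hj hi
  constructor
  · intro hlt
    by_contra hge
    push Not at hge
    have : v₀ j - v₀ i ≥ 0 := sub_nonneg.2 (le_of_lt (lt_of_le_of_ne hge (fun h' => hij (hv h'.symm))))
    rw [abs_of_nonneg this] at h
    linarith
  · intro hlt
    have : v₀ j - v₀ i < 0 := sub_neg.2 hlt
    rw [abs_of_neg this] at h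
    linarith

/-! ### Local constancy of `evenRound` -/

/-- `evenRound t = 2c` when `|t − 2c| < 1`. [folklore] -/
theorem evenRound_eq_of_abs_sub_lt {t : ℝ} {c : ℤ} (h : |t - 2 * c| < 1) : evenRound t = 2 * c := by
  unfold evenRound
  congr 1
  rw [round_eq_iff, Set.mem_Ico]
  rw [abs_lt] at h
  constructor <;> linarith

/-- **`evenRound` is locally constant off the odd integers**, in particular off `ℤ`: if `t₀ ∉ ℤ` and
`|t − t₀| < 1 − |offset t₀|` then `evenRound t = evenRound t₀`.
[folklore] -/
theorem evenRound_eq_evenRound {t₀ t : ℝ} (ht : |t - t₀| < 1 - |offset t₀|) :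
    evenRound t = evenRound t₀ := by
  have he : ∃ c : ℤ, evenRound t₀ = 2 * c := ⟨round (t₀ / 2), rfl⟩
  obtain ⟨c, hc⟩ := he
  rw [hc]
  apply evenRound_eq_of_abs_sub_lt
  have hoff : offset t₀ = t₀ - 2 * c := by rw [offset, hc]; push_cast; ring
  calc |t - 2 * c| = |(t - t₀) + offset t₀| := by rw [hoff]; ring_nf
    _ ≤ |t - t₀| + |offset t₀| := abs_add_le _ _
    _ < 1 := by linarith

/-! ### The regular set and local smoothness of `σ_m` -/

/-- **The regular set** `O`: every `|offset xᵢ|` lies strictly between `0` and `1` (no coordinate is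
an integer) and the `|offset xᵢ|` are pairwise distinct. It is open, and its complement lies in the
countable, locally finite family of hyperplanes `{xᵢ = c}`, `{xᵢ ± xⱼ = c}` (`c ∈ ℤ`).
[cite: Federer1969, 4.2.5–4.2.6] -/
def regularSet (n : ℕ) : Set (Fin n → ℝ) :=
  {x | (∀ i, 0 < |offset (x i)| ∧ |offset (x i)| < 1) ∧ ∀ i j, i ≠ j → |offset (x i)| ≠ |offset (x j)|}

/-- The regular set is open. [folklore] -/
theorem isOpen_regularSet : IsOpen (regularSet n) := by
  have hc : ∀ i : Fin n, Continuous fun x : Fin n → ℝ => |offset (x i)| := fun i =>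
    continuous_offset_abs.comp (continuous_apply i)
  have hA : IsOpen {x : Fin n → ℝ | ∀ i, 0 < |offset (x i)| ∧ |offset (x i)| < 1} := by
    simp only [Set.setOf_forall]
    exact isOpen_iInter_of_finite fun i => (isOpen_lt continuous_const (hc i)).inter
      (isOpen_lt (hc i) continuous_const)
  have hB : IsOpen {x : Fin n → ℝ | ∀ i j, i ≠ j → |offset (x i)| ≠ |offset (x j)|} := by
    simp only [Set.setOf_forall]
    refine isOpen_iInter_of_finite fun i => isOpen_iInter_of_finite fun j => ?_
    by_cases hij : i = j
    · convert isOpen_univ; ext x; simp [hij]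
    · convert isOpen_ne_fun (hc i) (hc j) using 1; ext x; simp [hij]
  exact hA.inter hB

/-- On the regular set no coordinate is an integer. [folklore] -/
theorem apply_ne_intCast_of_mem {x : Fin n → ℝ} (hx : x ∈ regularSet n) (i : Fin n) (z : ℤ) : x i ≠ z := by
  intro h
  have h0 := (hx.1 i).1
  have h1 := (hx.1 i).2
  rcases Int.even_or_odd z with hz | hz
  · -- even: offset = 0
    obtain ⟨c, rfl⟩ := hz
    have key : |offset (x i)| ≤ 0 := by
      calc |offset (x i)| ≤ |x i - 2 * (c : ℝ)| := by exact_mod_cast abs_offset_le_abs_sub (x i) c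
        _ = 0 := by rw [h]; push_cast; ring_nf; simp
    linarith
  · exact (ne_of_lt h1) ((abs_offset_eq_one_iff (x i)).2 ⟨z, hz, h⟩)

/-- **`σ_m` is the identity when `n ≤ m`** (`u_m = 1`). [cite: Federer1969, 4.2.6] -/
theorem sigma_eq_self_of_le {m : ℕ} (h : n ≤ m) (x : Fin n → ℝ) : sigma m x = x := by
  funext i
  simp only [sigma]
  rw [u_of_le h, div_one, clamp_of_abs_le (abs_offset_le_one _), offset_add_evenRound]

/-- A positive separation constant for the regular data at a point: all `|offset x₀ᵢ|`, all
`1 − |offset x₀ᵢ|` and all half-gaps `|vᵢ − vⱼ|/2` exceed `δ > 0`. [folklore] -/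
theorem exists_sep {x₀ : Fin n → ℝ} (hx : x₀ ∈ regularSet n) :
    ∃ δ > 0, (∀ i, δ < |offset (x₀ i)|) ∧ (∀ i, δ < 1 - |offset (x₀ i)|) ∧
      ∀ i j, i ≠ j → 2 * δ < abs (|offset (x₀ i)| - |offset (x₀ j)|) := by
  classical
  -- finitely many positive constraints
  set S : Finset ℝ := (Finset.univ.image fun i : Fin n => |offset (x₀ i)|) ∪
    (Finset.univ.image fun i : Fin n => 1 - |offset (x₀ i)|) ∪
    ((Finset.univ.filter fun p : Fin n × Fin n => p.1 ≠ p.2).image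
      fun p => abs (|offset (x₀ p.1)| - |offset (x₀ p.2)|) / 2) with hS
  have hpos : ∀ s ∈ S, 0 < s := by
    intro s hs
    simp only [hS, Finset.mem_union, Finset.mem_image, Finset.mem_univ, true_and, Finset.mem_filter] at hs
    rcases hs with (⟨i, rfl⟩ | ⟨i, rfl⟩) | ⟨p, hp, rfl⟩
    · exact (hx.1 i).1
    · linarith [(hx.1 i).2]
    · exact div_pos (abs_pos.2 (sub_ne_zero.2 (hx.2 _ _ hp))) two_pos
  by_cases hSe : S.Nonempty
  · refine ⟨S.min' hSe / 2, half_pos (hpos _ (Finset.min'_mem S hSe)), fun i => ?_, fun i => ?_, fun i j hij => ?_⟩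
    · have hm : S.min' hSe ≤ |offset (x₀ i)| := Finset.min'_le _ _ (by simp [hS])
      linarith [hpos _ (Finset.min'_mem S hSe)]
    · have hm : S.min' hSe ≤ 1 - |offset (x₀ i)| := Finset.min'_le _ _ (by simp [hS])
      linarith [hpos _ (Finset.min'_mem S hSe)]
    · have hm : S.min' hSe ≤ abs (|offset (x₀ i)| - |offset (x₀ j)|) / 2 :=
        Finset.min'_le _ _ (by
          simp only [hS, Finset.mem_union, Finset.mem_image, Finset.mem_filter, Finset.mem_univ, true_and]
          exact Or.inr ⟨(i, j), hij, rfl⟩)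
      have hp : 0 < abs (|offset (x₀ i)| - |offset (x₀ j)|) := abs_pos.2 (sub_ne_zero.2 (hx.2 _ _ hij))
      linarith
  · -- `n = 0`: anything works
    have hem : ∀ i : Fin n, False := fun i =>
      hSe ⟨_, Finset.mem_union_left _ (Finset.mem_union_left _ (Finset.mem_image_of_mem _ (Finset.mem_univ i)))⟩
    exact ⟨1, one_pos, fun i => (hem i).elim, fun i => (hem i).elim, fun i _ _ => (hem i).elim⟩

/-- **Local structure of `σ_m` on the regular set** (`m < n`): near `x₀` there are even integers
`Eᵢ`, signs `sᵢ = ±1` and the index `i₀` of rank `m` such that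
`σ_m(x)ᵢ = Eᵢ + (xᵢ − Eᵢ)/(s₀ (x_{i₀} − E₀))` for `rank i < m` and `σ_m(x)ᵢ = Eᵢ + sᵢ` otherwise.
[cite: Federer1969, 4.2.6] -/
theorem sigma_eventuallyEq {m : ℕ} (hm : m < n) {x₀ : Fin n → ℝ} (hx : x₀ ∈ regularSet n) :
    ∃ (i₀ : Fin n) (s : Fin n → ℝ), (∀ i, s i = 1 ∨ s i = -1) ∧ s i₀ * (x₀ i₀ - evenRound (x₀ i₀)) ≠ 0 ∧
      sigma m =ᶠ[𝓝 x₀] fun x i => (evenRound (x₀ i) : ℝ) +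
        if rank (fun j => |offset (x₀ j)|) i < m then (x i - evenRound (x₀ i)) / (s i₀ * (x i₀ - evenRound (x₀ i₀)))
        else s i := by
  set v₀ : Fin n → ℝ := fun j => |offset (x₀ j)| with hv₀
  have hv : Function.Injective v₀ := fun i j h => by
    by_contra hij; exact hx.2 i j hij h
  obtain ⟨i₀, hi₀⟩ := exists_rank_eq hv hm
  obtain ⟨δ, hδ, hδ0, hδ1, hδ2⟩ := exists_sep hx
  -- signs
  set s : Fin n → ℝ := fun i => if 0 ≤ offset (x₀ i) then 1 else -1 with hs
  have hs1 : ∀ i, s i = 1 ∨ s i = -1 := fun i => by simp only [hs]; split_ifs <;> simp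
  have hsabs : ∀ i, s i * offset (x₀ i) = |offset (x₀ i)| := fun i => by
    simp only [hs]; split_ifs with h
    · rw [one_mul, abs_of_nonneg h]
    · rw [neg_one_mul, abs_of_neg (not_le.1 h)]
  refine ⟨i₀, s, hs1, ?_, ?_⟩
  · rw [show x₀ i₀ - evenRound (x₀ i₀) = offset (x₀ i₀) from rfl, hsabs]
    exact (hx.1 i₀).1.ne'
  -- the neighbourhood `‖x − x₀‖ < δ`
  have hball : ∀ᶠ x in 𝓝 x₀, ∀ i, |x i - x₀ i| < δ := by
    have : Metric.ball x₀ δ ∈ 𝓝 x₀ := Metric.ball_mem_nhds _ hδ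
    filter_upwards [this] with x hx i
    rw [← Real.dist_eq]
    exact (dist_le_pi_dist x x₀ i).trans_lt (Metric.mem_ball.1 hx)
  filter_upwards [hball] with x hxδ
  -- `evenRound` unchanged, offsets shifted
  have hE : ∀ i, evenRound (x i) = evenRound (x₀ i) := fun i =>
    evenRound_eq_evenRound ((hxδ i).trans (hδ1 i))
  have hoff : ∀ i, offset (x i) = x i - evenRound (x₀ i) := fun i => by rw [offset, hE]
  have hoff₀ : ∀ i, offset (x₀ i) = x₀ i - evenRound (x₀ i) := fun i => rfl
  have hdo : ∀ i, |offset (x i) - offset (x₀ i)| < δ := fun i => by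
    rw [hoff, hoff₀, show x i - (evenRound (x₀ i) : ℝ) - (x₀ i - evenRound (x₀ i)) = x i - x₀ i by ring]
    exact hxδ i
  -- signs unchanged: `s i * offset (x i) = |offset (x i)| > 0`
  have hsx : ∀ i, s i * offset (x i) = |offset (x i)| ∧ 0 < |offset (x i)| := by
    intro i
    have h1 := hsabs i
    have h2 := hdo i
    have h3 := hδ0 i
    rcases hs1 i with h | h <;> rw [h] at h1 ⊢
    · rw [one_mul] at h1 ⊢
      have : 0 < offset (x i) := by
        rw [abs_lt] at h2
        have : 0 < offset (x₀ i) := by rw [h1]; exact (hx.1 i).1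
        linarith
      exact ⟨(abs_of_pos this).symm, abs_pos.2 this.ne'⟩
    · rw [neg_one_mul] at h1 ⊢
      have : offset (x i) < 0 := by
        rw [abs_lt] at h2
        have : offset (x₀ i) < 0 := by
          have h4 : 0 < -offset (x₀ i) := by rw [h1]; exact (hx.1 i).1
          linarith
        linarith
      exact ⟨(abs_of_neg this).symm, abs_pos.2 this.ne⟩
  -- ranks unchanged, `u_m x = |offset (x i₀)|`
  set w : Fin n → ℝ := fun j => |offset (x j)| with hw
  have hwv : ∀ i, |w i - v₀ i| < δ := fun i => lt_of_le_of_lt (abs_abs_sub_abs_le_abs_sub _ _) (hdo i)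
  have hwinj : Function.Injective w := by
    intro i j h
    by_contra hij
    have h2 := hδ2 i j hij
    have hi := hwv i
    have hj := hwv j
    rw [abs_lt] at hi hj
    have : |v₀ i - v₀ j| < 2 * δ := by
      rw [abs_lt]; constructor <;> linarith [h]
    simp only [hv₀] at this
    linarith
  have hrank : ∀ i, rank w i = rank v₀ i := fun i => rank_eq_rank_of_close hv hδ2 hwv i
  have hu : u m x = |offset (x i₀)| := by
    show kth m w = w i₀
    exact kth_eq_of_rank hwinj ((hrank i₀).trans hi₀)
  have hu' : u m x = s i₀ * (x i₀ - evenRound (x₀ i₀)) := by rw [hu, ← (hsx i₀).1, hoff]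
  have hupos : 0 < u m x := by rw [hu]; exact (hsx i₀).2
  -- coordinates
  have hwu : w i₀ = u m x := hu.symm
  funext i
  simp only [sigma]
  rw [hE i]
  congr 1
  split_ifs with hri
  · -- `rank i < m`: `|offset (x i)| < u`, clamp is the identity
    rw [← hu', ← hoff i]
    refine clamp_div_of_abs_le hupos ?_
    have hlt : w i < w i₀ := (rank_lt_rank hwinj).1 (by rw [hrank i, hrank i₀, hi₀]; exact hri)
    rw [hu]; exact hlt.le
  · by_cases hii : i = i₀
    · -- `i = i₀`: the ratio is `± 1`
      subst hii
      have hne : offset (x i) ≠ 0 := abs_pos.1 (hsx i).2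
      rcases hs1 i with h | h <;> rw [h]
      · have h1 := (hsx i).1
        rw [h, one_mul] at h1
        rw [hu, ← h1, div_self hne]
        exact clamp_of_abs_le (by simp)
      · have h1 := (hsx i).1
        rw [h, neg_one_mul] at h1
        rw [hu, ← h1, div_neg, div_self hne]
        exact clamp_of_le_neg_one le_rfl
    · -- `rank i > m`: `|offset (x i)| > u`, clamp is `± 1`
      have hgt' : m < rank v₀ i := by
        refine lt_of_le_of_ne (not_lt.1 hri) fun h => hii ?_
        -- equal ranks force equal indices
        by_contra hne
        rcases lt_or_gt_of_ne (hv.ne hne) with hlt | hlt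
        · have := (rank_lt_rank hv).2 hlt; omega
        · have := (rank_lt_rank hv).2 hlt; omega
      have hgt : w i₀ < w i := (rank_lt_rank hwinj).1 (by rw [hrank i₀, hrank i, hi₀]; exact hgt')
      have hle1 : u m x ≤ |offset (x i)| := by rw [← hwu]; exact hgt.le
      rw [clamp_div_of_le_abs hupos hle1]
      rcases hs1 i with h | h <;> rw [h]
      · have h1 := (hsx i).1
        rw [h, one_mul] at h1
        have hpos : 0 < offset (x i) := by rw [h1]; exact (hsx i).2
        rw [if_pos hpos.le]
      · have h1 := (hsx i).1
        rw [h, neg_one_mul] at h1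
        have hneg : offset (x i) < 0 := by
          have : 0 < -offset (x i) := by rw [h1]; exact (hsx i).2
          linarith
        rw [if_neg (not_le.2 hneg)]

/-- **`σ_m` is smooth at every point of the regular set.** [cite: Federer1969, 4.2.6] -/
theorem contDiffAt_sigma (m : ℕ) {x₀ : Fin n → ℝ} (hx : x₀ ∈ regularSet n) : ContDiffAt ℝ ∞ (sigma m) x₀ := by
  rcases le_or_gt n m with hnm | hm
  · have : sigma (n := n) m = id := funext fun x => sigma_eq_self_of_le hnm x
    rw [this]; exact contDiffAt_id
  obtain ⟨i₀, s, hs, hden, heq⟩ := sigma_eventuallyEq hm hx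
  refine ContDiffAt.congr_of_eventuallyEq ?_ heq
  refine contDiffAt_pi.2 fun i => contDiffAt_const.add ?_
  split_ifs with h
  · refine ContDiffAt.div ((contDiffAt_apply ℝ ℝ i x₀).sub contDiffAt_const)
      (contDiffAt_const.mul ((contDiffAt_apply ℝ ℝ i₀ x₀).sub contDiffAt_const)) ?_
    exact hden
  · exact contDiffAt_const

/-- **The complement of the regular set lies in the hyperplane arrangement**
`⋃ {xᵢ = c} ∪ ⋃ {xᵢ − xⱼ = c} ∪ ⋃ {xᵢ + xⱼ = c}` (`c ∈ ℤ`, `i ≠ j`). [cite: Federer1969, 4.2.5] -/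
theorem exists_of_not_mem_regularSet {x : Fin n → ℝ} (hx : x ∉ regularSet n) :
    (∃ i, ∃ c : ℤ, x i = c) ∨ ∃ i j, i ≠ j ∧ ∃ c : ℤ, x i - x j = c ∨ x i + x j = c := by
  simp only [regularSet, Set.mem_setOf_eq, not_and_or, not_forall] at hx
  rcases hx with ⟨i, hi⟩ | ⟨i, j, hij, hne⟩
  · left
    refine ⟨i, ?_⟩
    rcases hi with h0 | h1
    · -- `offset = 0`: `x i` is the even integer `evenRound`
      have h0' : offset (x i) = 0 := by
        have := abs_nonneg (offset (x i)); rw [not_lt] at h0; exact abs_eq_zero.1 (le_antisymm h0 this)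
      refine ⟨evenRound (x i), ?_⟩
      have := offset_add_evenRound (x i)
      rw [h0', add_zero] at this
      exact this.symm
    · -- `|offset| = 1`: odd integer
      have h1' : |offset (x i)| = 1 := le_antisymm (abs_offset_le_one _) (not_lt.1 h1)
      obtain ⟨z, -, hz⟩ := (abs_offset_eq_one_iff (x i)).1 h1'
      exact ⟨z, hz⟩
  · right
    have hne' : i ≠ j := by simpa using hij
    refine ⟨i, j, hne', ?_⟩
    have heq : |offset (x i)| = |offset (x j)| := by simpa using hne
    rcases abs_eq_abs.1 heq with h | h
    · refine ⟨evenRound (x i) - evenRound (x j), Or.inl ?_⟩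
      simp only [offset] at h
      push_cast
      linarith
    · refine ⟨evenRound (x i) + evenRound (x j), Or.inr ?_⟩
      simp only [offset] at h
      push_cast
      linarith

/-! ### Transfer to `V`: smoothness of `σ^ε` off a hyperplane arrangement -/

section Transfer

open scoped InnerProductSpace RealInnerProductSpace

variable {V : Type*} [NormedAddCommGroup V] [InnerProductSpace ℝ V] (b : OrthonormalBasis (Fin n) ℝ V)

/-- `uncoord` is smooth (it is linear). [folklore] -/
theorem contDiff_uncoord : ContDiff ℝ ∞ (uncoord b) := by
  unfold uncoord
  exact ContDiff.sum fun i _ => (contDiff_apply ℝ ℝ i).smul contDiff_const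

/-- `model` is smooth (it is linear). [folklore] -/
theorem contDiff_model (ε : ℝ) : ContDiff ℝ ∞ (model b ε) := by
  have : model b ε = fun x => ε⁻¹ • coord b x := rfl
  rw [this]
  have hc : ContDiff ℝ ∞ (coord b) :=
    contDiff_pi.2 fun i => (contDiff_const.inner ℝ contDiff_id : ContDiff ℝ ∞ fun x : V => ⟪b i, x⟫_ℝ)
  exact (contDiff_const (c := ε⁻¹)).smul hc

/-- **`σ^ε` is smooth at every point whose model coordinates are regular.** [cite: Federer1969, 4.2.6] -/
theorem contDiffAt_sigmaV (m : ℕ) (ε : ℝ) {x₀ : V} (hx : model b ε x₀ ∈ regularSet n) :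
    ContDiffAt ℝ ∞ (sigmaV b m ε) x₀ := by
  unfold sigmaV
  refine (contDiff_uncoord b).contDiffAt.comp x₀ ?_
  have h1 : ContDiffAt ℝ ∞ (fun x => sigma m (model b ε x)) x₀ :=
    (contDiffAt_sigma m hx).comp x₀ (contDiff_model b ε).contDiffAt
  exact (contDiffAt_const (c := ε)).smul h1

/-- **The singular set of `σ^ε`**: points whose model coordinates are not regular. It is closed and
contained in the countable family of affine hyperplanes `⟪ν, x⟫ = ε c` with
`ν ∈ {bᵢ, bᵢ − bⱼ, bᵢ + bⱼ}`, `c ∈ ℤ`. [cite: Federer1969, 4.2.5] -/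
def singularSetV (b : OrthonormalBasis (Fin n) ℝ V) (ε : ℝ) : Set V := {x | model b ε x ∉ regularSet n}

/-- The singular set is closed. [folklore] -/
theorem isClosed_singularSetV (ε : ℝ) : IsClosed (singularSetV b ε) := by
  have : singularSetV b ε = (model b ε) ⁻¹' (regularSet n)ᶜ := rfl
  rw [this]
  exact (isOpen_regularSet.isClosed_compl).preimage (contDiff_model b ε).continuous

/-- The (finite) set of normals of the arrangement: `bᵢ`, `bᵢ − bⱼ`, `bᵢ + bⱼ` (`i ≠ j`).
[cite: Federer1969, 4.2.5] -/
def normals (b : OrthonormalBasis (Fin n) ℝ V) : Set V :=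
  Set.range (fun i => b i) ∪ ((fun p : Fin n × Fin n => b p.1 - b p.2) '' {p | p.1 ≠ p.2}) ∪
    ((fun p : Fin n × Fin n => b p.1 + b p.2) '' {p | p.1 ≠ p.2})

/-- The set of normals is finite. [folklore] -/
theorem finite_normals : (normals b).Finite :=
  ((Set.finite_range _).union ((Set.toFinite _).image _)).union ((Set.toFinite _).image _)

/-- **The singular set lies in the hyperplane arrangement.** [cite: Federer1969, 4.2.5] -/
theorem singularSetV_subset {ε : ℝ} (hε : ε ≠ 0) :
    singularSetV b ε ⊆ ⋃ ν ∈ normals b, ⋃ c : ℤ, {x : V | ⟪ν, x⟫_ℝ = ε * c} := by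
  intro x hx
  simp only [Set.mem_iUnion, Set.mem_setOf_eq, exists_prop]
  have hm : ∀ i, model b ε x i = ε⁻¹ * ⟪b i, x⟫_ℝ := fun i => rfl
  rcases exists_of_not_mem_regularSet hx with ⟨i, c, hc⟩ | ⟨i, j, hij, c, hc⟩
  · refine ⟨b i, Or.inl (Or.inl ⟨i, rfl⟩), c, ?_⟩
    rw [hm] at hc
    field_simp at hc
    linarith
  · rcases hc with hc | hc
    · refine ⟨b i - b j, Or.inl (Or.inr ⟨(i, j), hij, rfl⟩), c, ?_⟩
      rw [hm, hm] at hc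
      rw [inner_sub_left]
      field_simp at hc
      linarith
    · refine ⟨b i + b j, Or.inr ⟨(i, j), hij, rfl⟩, c, ?_⟩
      rw [hm, hm] at hc
      rw [inner_add_left]
      field_simp at hc
      linarith

/-- The normals are nonzero. [folklore] -/
theorem ne_zero_of_mem_normals {ν : V} (hν : ν ∈ normals b) : ν ≠ 0 := by
  rcases hν with (⟨i, rfl⟩ | ⟨p, hp, rfl⟩) | ⟨p, hp, rfl⟩
  · exact b.orthonormal.ne_zero i
  · intro h
    have h' : b p.1 - b p.2 = 0 := h
    exact hp (b.orthonormal.linearIndependent.injective (sub_eq_zero.1 h'))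
  · intro h
    have h' : b p.1 + b p.2 = 0 := h
    have h1 : ⟪b p.1, b p.1 + b p.2⟫_ℝ = 0 := by rw [h', inner_zero_right]
    rw [inner_add_right, real_inner_self_eq_norm_sq, b.orthonormal.1 p.1,
      b.orthonormal.2 (show p.1 ≠ p.2 from hp)] at h1
    norm_num at h1

end Transfer

/-! ### Translate-avoidance: almost every translate of the arrangement is uncharged -/

section Avoid

open MeasureTheory MeasureTheory.Measure

/-- **Level sets of a nonzero linear functional are Haar-null.** [folklore] -/
theorem addHaar_levelSet_eq_zero {E : Type*} [NormedAddCommGroup E] [NormedSpace ℝ E]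
    [MeasurableSpace E] [BorelSpace E] [FiniteDimensional ℝ E] (μ : Measure E) [IsAddHaarMeasure μ]
    (ℓ : E →ₗ[ℝ] ℝ) (hℓ : ℓ ≠ 0) (t : ℝ) : μ {a | ℓ a = t} = 0 := by
  rcases Set.eq_empty_or_nonempty {a : E | ℓ a = t} with h | ⟨a₀, ha₀⟩
  · rw [h, measure_empty]
  · have hker : (LinearMap.ker ℓ : Submodule ℝ E) ≠ ⊤ := by
      rwa [Ne, LinearMap.ker_eq_top]
    have hset : {a : E | ℓ a = t} = (fun a => a + -a₀) ⁻¹' (LinearMap.ker ℓ : Set E) := by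
      ext a
      simp only [Set.mem_setOf_eq, Set.mem_preimage, SetLike.mem_coe, LinearMap.mem_ker, map_add, map_neg]
      have : ℓ a₀ = t := ha₀
      constructor <;> intro h' <;> linarith
    rw [hset, measure_preimage_add_right]
    exact addHaar_submodule μ _ hker

/-- Hence the preimage of a countable set under a nonzero linear functional is Haar-null. [folklore] -/
theorem addHaar_preimage_countable_eq_zero {E : Type*} [NormedAddCommGroup E] [NormedSpace ℝ E]
    [MeasurableSpace E] [BorelSpace E] [FiniteDimensional ℝ E] (μ : Measure E) [IsAddHaarMeasure μ]
    (ℓ : E →ₗ[ℝ] ℝ) (hℓ : ℓ ≠ 0) {C : Set ℝ} (hC : C.Countable) : μ {a | ℓ a ∈ C} = 0 := by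
  have : {a : E | ℓ a ∈ C} = ⋃ t ∈ C, {a | ℓ a = t} := by ext a; simp
  rw [this, measure_biUnion_null_iff hC]
  exact fun t _ => addHaar_levelSet_eq_zero μ ℓ hℓ t

variable {V : Type*} [NormedAddCommGroup V] [InnerProductSpace ℝ V] [MeasurableSpace V] [BorelSpace V]
  (b : OrthonormalBasis (Fin n) ℝ V)

omit [NormedAddCommGroup V] [InnerProductSpace ℝ V] [BorelSpace V] in
/-- **Only countably many levels of a measurable function are charged** by a finite measure.
[folklore] -/
theorem countable_charged_levels (μ : Measure V) [IsFiniteMeasure μ] {L : V → ℝ} (hL : Measurable L) :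
    {t : ℝ | μ {x | L x = t} ≠ 0}.Countable := by
  have := Measure.countable_meas_pos_of_disjoint_iUnion (μ := μ) (As := fun t : ℝ => {x | L x = t})
    (fun t => hL (measurableSet_singleton t)) (fun t s hts => Set.disjoint_left.2
      fun x (hx : L x = t) (hx' : L x = s) => hts (hx.symm.trans hx'))
  refine this.mono fun t ht => ?_
  exact pos_iff_ne_zero.2 ht

/-- The evaluation functionals and their differences / sums on `Fin n → ℝ`. [folklore] -/
def evalFun (i : Fin n) : (Fin n → ℝ) →ₗ[ℝ] ℝ := LinearMap.proj i

/-- `evalFun i ≠ 0`. [folklore] -/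
theorem evalFun_ne_zero (i : Fin n) : (evalFun i : (Fin n → ℝ) →ₗ[ℝ] ℝ) ≠ 0 := by
  intro h
  have := LinearMap.congr_fun h (Pi.single i 1)
  simp [evalFun] at this

/-- `evalFun i − evalFun j ≠ 0` for `i ≠ j`. [folklore] -/
theorem evalFun_sub_ne_zero {i j : Fin n} (hij : i ≠ j) : (evalFun i - evalFun j : (Fin n → ℝ) →ₗ[ℝ] ℝ) ≠ 0 := by
  intro h
  have := LinearMap.congr_fun h (Pi.single i 1)
  simp [evalFun, hij.symm] at this

/-- `evalFun i + evalFun j ≠ 0`. [folklore] -/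
theorem evalFun_add_ne_zero (i j : Fin n) : (evalFun i + evalFun j : (Fin n → ℝ) →ₗ[ℝ] ℝ) ≠ 0 := by
  intro h
  have := LinearMap.congr_fun h (Pi.single i 1)
  by_cases hij : j = i
  · subst hij; simp [evalFun] at this
  · simp [evalFun, hij] at this

/-- **Translate-avoidance** [used in Federer 4.2.9 alongside 4.2.7]: for a finite measure `μ` on `V`
and almost every model translation `a`, the translated singular set `{x : model x + a ∉ O}` is
`μ`-null (it lies in countably many level sets of finitely many linear functionals, and only
countably many levels of each are charged). [cite: Federer1969, 4.2.9] -/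
theorem ae_measure_translate_singular_eq_zero (μ : Measure V) [IsFiniteMeasure μ] (ε : ℝ) :
    ∀ᵐ a ∂(volume : Measure (Fin n → ℝ)), μ {x | model b ε x + a ∉ regularSet n} = 0 := by
  -- the linear functionals on `V` and their charged levels
  have hLm : ∀ i, Measurable fun x : V => model b ε x i := fun i =>
    (continuous_apply i).measurable.comp (measurable_model b)
  set S₁ : Fin n → Set ℝ := fun i => {t | μ {x | model b ε x i = t} ≠ 0}
  set S₂ : Fin n → Fin n → Set ℝ := fun i j => {t | μ {x | model b ε x i - model b ε x j = t} ≠ 0}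
  set S₃ : Fin n → Fin n → Set ℝ := fun i j => {t | μ {x | model b ε x i + model b ε x j = t} ≠ 0}
  have hS₁ : ∀ i, (S₁ i).Countable := fun i => countable_charged_levels μ (hLm i)
  have hS₂ : ∀ i j, (S₂ i j).Countable := fun i j => countable_charged_levels μ ((hLm i).sub (hLm j))
  have hS₃ : ∀ i j, (S₃ i j).Countable := fun i j => countable_charged_levels μ ((hLm i).add (hLm j))
  -- the bad translations
  set C₁ : Fin n → Set ℝ := fun i => ⋃ c : ℤ, (fun t => (c : ℝ) - t) '' S₁ i
  set C₂ : Fin n → Fin n → Set ℝ := fun i j => ⋃ c : ℤ, (fun t => (c : ℝ) - t) '' S₂ i j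
  set C₃ : Fin n → Fin n → Set ℝ := fun i j => ⋃ c : ℤ, (fun t => (c : ℝ) - t) '' S₃ i j
  have hC₁ : ∀ i, (C₁ i).Countable := fun i => Set.countable_iUnion fun c => (hS₁ i).image _
  have hC₂ : ∀ i j, (C₂ i j).Countable := fun i j => Set.countable_iUnion fun c => (hS₂ i j).image _
  have hC₃ : ∀ i j, (C₃ i j).Countable := fun i j => Set.countable_iUnion fun c => (hS₃ i j).image _
  set Bad : Set (Fin n → ℝ) := (⋃ i, {a | evalFun i a ∈ C₁ i}) ∪
    (⋃ i, ⋃ j, ⋃ (_ : i ≠ j), {a | (evalFun i - evalFun j) a ∈ C₂ i j}) ∪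
    (⋃ i, ⋃ j, {a | (evalFun i + evalFun j) a ∈ C₃ i j})
  have hBad : volume Bad = 0 := by
    refine measure_union_null (measure_union_null (measure_iUnion_null fun i => ?_)
      (measure_iUnion_null fun i => measure_iUnion_null fun j => measure_iUnion_null fun hij => ?_))
      (measure_iUnion_null fun i => measure_iUnion_null fun j => ?_)
    · exact addHaar_preimage_countable_eq_zero volume _ (evalFun_ne_zero i) (hC₁ i)
    · exact addHaar_preimage_countable_eq_zero volume _ (evalFun_sub_ne_zero hij) (hC₂ i j)
    · exact addHaar_preimage_countable_eq_zero volume _ (evalFun_add_ne_zero i j) (hC₃ i j)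
  rw [ae_iff]
  refine measure_mono_null (fun a ha => ?_) hBad
  -- a translation charging the singular set is bad
  simp only [Set.mem_setOf_eq] at ha
  by_contra hgood
  apply ha
  -- cover the translated singular set by null level sets
  have hcov : {x : V | model b ε x + a ∉ regularSet n} ⊆
      (⋃ i, ⋃ c : ℤ, {x | model b ε x i = c - a i}) ∪
      (⋃ i, ⋃ j, ⋃ (_ : i ≠ j), ⋃ c : ℤ, ({x | model b ε x i - model b ε x j = c - (a i - a j)} ∪
        {x | model b ε x i + model b ε x j = c - (a i + a j)})) := by
    intro x hx
    rcases exists_of_not_mem_regularSet hx with ⟨i, c, hc⟩ | ⟨i, j, hij, c, hc⟩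
    · left
      simp only [Set.mem_iUnion, Set.mem_setOf_eq]
      refine ⟨i, c, ?_⟩
      simp only [Pi.add_apply] at hc
      linarith
    · right
      simp only [Set.mem_iUnion, Set.mem_union, Set.mem_setOf_eq]
      refine ⟨i, j, hij, c, ?_⟩
      simp only [Pi.add_apply] at hc
      rcases hc with hc | hc
      · left; linarith
      · right; linarith
  refine measure_mono_null hcov (measure_union_null (measure_iUnion_null fun i => measure_iUnion_null fun c => ?_)
    (measure_iUnion_null fun i => measure_iUnion_null fun j => measure_iUnion_null fun hij =>
      measure_iUnion_null fun c => measure_union_null ?_ ?_))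
  · -- `c − a i ∉ S₁ i` since `a i ∉ C₁ i`
    by_contra hne
    apply hgood
    refine Or.inl (Or.inl (Set.mem_iUnion.2 ⟨i, ?_⟩))
    show a i ∈ C₁ i
    exact Set.mem_iUnion.2 ⟨c, (c : ℝ) - a i, hne, by ring⟩
  · by_contra hne
    apply hgood
    refine Or.inl (Or.inr (Set.mem_iUnion.2 ⟨i, Set.mem_iUnion.2 ⟨j, Set.mem_iUnion.2 ⟨hij, ?_⟩⟩⟩))
    show a i - a j ∈ C₂ i j
    exact Set.mem_iUnion.2 ⟨c, (c : ℝ) - (a i - a j), hne, by ring⟩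
  · by_contra hne
    apply hgood
    refine Or.inr (Set.mem_iUnion.2 ⟨i, Set.mem_iUnion.2 ⟨j, ?_⟩⟩)
    show a i + a j ∈ C₃ i j
    exact Set.mem_iUnion.2 ⟨c, (c : ℝ) - (a i + a j), hne, by ring⟩

end Avoid

/-! ### Good translations avoiding an additional null set -/

section Translate

open MeasureTheory MeasureTheory.Measure
open scoped ENNReal

/-- **Good translations, avoiding a prescribed null set** (model form): the averaging lemma
`CubicalAverage.exists_good_translate` together with an arbitrary Lebesgue-null set `N` of
forbidden translations. [cite: Federer1969, 4.2.7, 4.2.9] -/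
theorem exists_good_translate' (ρ₁ ρ₂ : Measure (Fin n → ℝ)) [IsFiniteMeasure ρ₁]
    [IsFiniteMeasure ρ₂] (m₁ m₂ : ℕ) {N : Set (Fin n → ℝ)} (hN : volume N = 0) :
    ∃ a ∈ transCube n, a ∉ N ∧
      ρ₁ {x | u m₁ (x + a) = 0} = 0 ∧ ρ₂ {x | u m₂ (x + a) = 0} = 0 ∧
      ∫⁻ x, ENNReal.ofReal (upow m₁ (x + a)) ∂ρ₁ ≤
        ENNReal.ofReal (4 * avgConst n m₁ / 2 ^ n) * ρ₁ Set.univ ∧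
      ∫⁻ x, ENNReal.ofReal (upow m₂ (x + a)) ∂ρ₂ ≤
        ENNReal.ofReal (4 * avgConst n m₂ / 2 ^ n) * ρ₂ Set.univ := by
  set B₁ := {a : Fin n → ℝ | ¬(∫⁻ x, ENNReal.ofReal (upow m₁ (x + a)) ∂ρ₁ ≤
      ENNReal.ofReal (4 * avgConst n m₁ / 2 ^ n) * ρ₁ Set.univ)}
  set B₂ := {a : Fin n → ℝ | ¬(∫⁻ x, ENNReal.ofReal (upow m₂ (x + a)) ∂ρ₂ ≤
      ENNReal.ofReal (4 * avgConst n m₂ / 2 ^ n) * ρ₂ Set.univ)}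
  set N₁ := {a : Fin n → ℝ | ¬ρ₁ {x | u m₁ (x + a) = 0} = 0}
  set N₂ := {a : Fin n → ℝ | ¬ρ₂ {x | u m₂ (x + a) = 0} = 0}
  have hN₁ : volume N₁ = 0 := by
    have := ae_measure_u_add_eq_zero ρ₁ m₁; rwa [ae_iff] at this
  have hN₂ : volume N₂ = 0 := by
    have := ae_measure_u_add_eq_zero ρ₂ m₂; rwa [ae_iff] at this
  have hB₁ := volume_bad_le ρ₁ m₁
  have hB₂ := volume_bad_le ρ₂ m₂
  have hbad : volume (transCube n ∩ (B₁ ∪ B₂ ∪ N₁ ∪ N₂ ∪ N)) < volume (transCube n) := by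
    calc volume (transCube n ∩ (B₁ ∪ B₂ ∪ N₁ ∪ N₂ ∪ N))
        ≤ volume (transCube n ∩ B₁) + volume (transCube n ∩ B₂) + volume N₁ + volume N₂ + volume N := by
          refine (measure_mono fun a ha => ?_).trans
            ((measure_union_le _ _).trans (add_le_add ((measure_union_le _ _).trans (add_le_add
              ((measure_union_le _ _).trans (add_le_add (measure_union_le _ _) le_rfl)) le_rfl)) le_rfl))
          rcases ha.2 with (((h | h) | h) | h) | h
          · exact Or.inl (Or.inl (Or.inl (Or.inl ⟨ha.1, h⟩)))
          · exact Or.inl (Or.inl (Or.inl (Or.inr ⟨ha.1, h⟩)))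
          · exact Or.inl (Or.inl (Or.inr h))
          · exact Or.inl (Or.inr h)
          · exact Or.inr h
      _ ≤ ENNReal.ofReal (2 ^ n / 4) + ENNReal.ofReal (2 ^ n / 4) + 0 + 0 + 0 := by
          gcongr
          · exact hN₁.le
          · exact hN₂.le
          · exact hN.le
      _ < volume (transCube n) := by
          rw [add_zero, add_zero, add_zero, volume_transCube, ← ENNReal.ofReal_add (by positivity) (by positivity),
            ENNReal.ofReal_lt_ofReal_iff (by positivity)]
          linarith [show (0 : ℝ) < 2 ^ n by positivity]
  have hne : (transCube n \ (B₁ ∪ B₂ ∪ N₁ ∪ N₂ ∪ N)).Nonempty := by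
    by_contra h
    rw [Set.not_nonempty_iff_eq_empty, Set.sdiff_eq_empty] at h
    exact hbad.ne (by rw [Set.inter_eq_left.2 h])
  obtain ⟨a, haA, ha⟩ := hne
  simp only [Set.mem_union, not_or] at ha
  obtain ⟨⟨⟨⟨hb₁, hb₂⟩, hn₁⟩, hn₂⟩, hn⟩ := ha
  exact ⟨a, haA, hn, not_not.1 hn₁, not_not.1 hn₂, not_not.1 hb₁, not_not.1 hb₂⟩

variable {V : Type*} [NormedAddCommGroup V] [InnerProductSpace ℝ V] [MeasurableSpace V] [BorelSpace V]
  (b : OrthonormalBasis (Fin n) ℝ V)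

/-- **Good translations on `V`, avoiding the arrangements of `σ^ε` for finitely many measures**:
beside the conclusions of `CubicalModel.exists_good_translateV`, the translated singular set
`{x : model x + a ∉ O}` is null for each of the finitely many given finite measures `ν_k`
(`ae_measure_translate_singular_eq_zero`). [cite: Federer1969, 4.2.7, 4.2.9] -/
theorem exists_good_translateV' {ε : ℝ} (ρ₁ ρ₂ : Measure V) [IsFiniteMeasure ρ₁] [IsFiniteMeasure ρ₂]
    (m₁ m₂ : ℕ) {K : ℕ} (ν : Fin K → Measure V) [∀ k, IsFiniteMeasure (ν k)] :
    ∃ a ∈ transCube n,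
      (∀ k, ν k {x | model b ε x + a ∉ regularSet n} = 0) ∧
      ρ₁ {x | u m₁ (model b ε x + a) = 0} = 0 ∧ ρ₂ {x | u m₂ (model b ε x + a) = 0} = 0 ∧
      ∫⁻ x, ENNReal.ofReal (upow m₁ (model b ε x + a)) ∂ρ₁ ≤
        ENNReal.ofReal (4 * avgConst n m₁ / 2 ^ n) * ρ₁ Set.univ ∧
      ∫⁻ x, ENNReal.ofReal (upow m₂ (model b ε x + a)) ∂ρ₂ ≤
        ENNReal.ofReal (4 * avgConst n m₂ / 2 ^ n) * ρ₂ Set.univ := by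
  have hm := measurable_model b (ε := ε)
  set ρ₁' := ρ₁.map (model b ε)
  set ρ₂' := ρ₂.map (model b ε)
  haveI : IsFiniteMeasure ρ₁' := Measure.isFiniteMeasure_map ρ₁ _
  haveI : IsFiniteMeasure ρ₂' := Measure.isFiniteMeasure_map ρ₂ _
  -- the forbidden null set
  set N : Set (Fin n → ℝ) := ⋃ k, {a | ¬ν k {x | model b ε x + a ∉ regularSet n} = 0}
  have hN : volume N = 0 := by
    refine measure_iUnion_null fun k => ?_
    have := ae_measure_translate_singular_eq_zero b (ν k) ε
    rwa [ae_iff] at this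
  obtain ⟨a, ha, haN, h1, h2, h3, h4⟩ := exists_good_translate' ρ₁' ρ₂' m₁ m₂ hN
  have hmeas : ∀ k, MeasurableSet {w : Fin n → ℝ | u k (w + a) = 0} := fun k =>
    (isClosed_eq ((continuous_u k).comp (continuous_id.add continuous_const)) continuous_const).measurableSet
  have hmeas' : ∀ k, Measurable fun w : Fin n → ℝ => ENNReal.ofReal (upow k (w + a)) := fun k =>
    ENNReal.measurable_ofReal.comp ((measurable_upow k).comp (measurable_id.add measurable_const))
  refine ⟨a, ha, fun k => ?_, ?_, ?_, ?_, ?_⟩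
  · by_contra h
    exact haN (Set.mem_iUnion.2 ⟨k, h⟩)
  · rw [Measure.map_apply hm (hmeas m₁)] at h1; exact h1
  · rw [Measure.map_apply hm (hmeas m₂)] at h2; exact h2
  · rw [lintegral_map (hmeas' m₁) hm, Measure.map_apply hm MeasurableSet.univ] at h3; exact h3
  · rw [lintegral_map (hmeas' m₂) hm, Measure.map_apply hm MeasurableSet.univ] at h4; exact h4

end Translate

end Cubical

end Literature.Geometry.GeometricMeasureTheory
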